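import Literature.NumberTheory.EllipticCurves.Kato2004.IwasawaTwistTateShapiroTowerProofs
import Literature.NumberTheory.EllipticCurves.Kato2004.IwasawaH1LayerNormProofs
import Literature.NumberTheory.GaloisRepresentations.ContinuousH1AddHomExactProofs
import Literature.NumberTheory.GaloisRepresentations.DiscreteModuleInverseLimitH1
import HarnessLib

/-!
# Kato (2004), §13.8 / §14.14 — the twisted-Tate Shapiro tower, III: the limit class of a pinned
  element and the class `Θ` with `(γ − 1) Θ = Ξ`

Literature layer — PROOFS ONLY, no new definitions, no axioms.  Third file of the chain
`IwasawaTwistTateSystem → …ExactProofs → …ShapiroProofs → …ToTateH1Proofs → …ShapiroTowerProofs`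
towards the left exactness of Kato's (14.14.1) [cite: Kato2004Asterisque, §14.14 (p. 243)] on the pinned
Iwasawa cohomology `I : IwasawaH1Data W p κ γ` (`Kato2004/IwasawaCohomology.lean`), in the
finite-coefficient Shapiro model `𝕋 = lim_{(n,k)} P_{(n,k)}`, `P_{(n,k)} = W[p^k] ⊗ ℤ[Gal(ℚ_n/ℚ)]`.
For `x ∈ 𝐇¹` with layer classes `x_n = proj n x ∈ H¹(ℚ_n, T)`:

* §9 the classes `ξ_a = cor_{Γ_{a₁}→Γ_0} (H¹(δ_0) (x_{a₁} mod p^{a₂})) ∈ H¹(Γ_0, P_a)` form an element of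
  `lim_a H¹(Γ_0, P_a)` (`mapH1AddHom_red_xi`: trace compatibility of the pin + naturality of the
  inverse Shapiro map), hence (NSW 2.7.5, surjectivity) come from ONE class `Ξ ∈ H¹(Γ_0, 𝕋)`
  (`exists_limit_class`);
* §10 `H¹(toTate n) (res_{Γ_0→Γ_n} Ξ) = x_n` (`mapH1AddHom_toTate_resLe_limit_class`; both sides agree
  mod every `p^k` by the Shapiro identity `H¹(ev_0) ∘ res ∘ cor ∘ H¹(δ_0) = id`, and `H¹(ℚ_n, T)` is
  `p`-adically separated), so `H¹(toTate 0) Ξ = 0` when `x_0 = 0`, and then the exactness of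
  `H¹(Γ_0, 𝕋) →(γ−1) H¹(Γ_0, 𝕋) → H¹(Γ_0, T)` (closed-embedding kernel, `ContinuousH1AddHomExactProofs`)
  produces `Θ` with `H¹(shift − 1) Θ = Ξ` (`exists_shift_sub_class`).

References: K. Kato, *p-adic Hodge theory and values of zeta functions of modular forms*, Astérisque 295
(2004), §12.2, §13.8, §14.14 [cite: Kato2004Asterisque]; J. Neukirch, A. Schmidt, K. Wingberg,
*Cohomology of Number Fields* (2008), II §7 [cite: NeukirchSchmidtWingberg2008].
-/

noncomputable section

open scoped Topology NumberField
open Field Filter CategoryTheory Finset IsDedekindDomain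
open Literature.NumberTheory.GaloisRepresentations
open Literature.NumberTheory.EllipticCurves
open WeierstrassCurve (geomPoints geomTorsion)

namespace Literature.NumberTheory.EllipticCurves.Kato2004

open Literature.NumberTheory.EllipticCurves.Kato2004.EulerSystemValues
open Literature.NumberTheory.EllipticCurves.IwasawaAlgebra

namespace TwistTate

variable (W : WeierstrassCurve ℚ) [W.IsElliptic] (p : ℕ) [Fact p.Prime]
  [ContinuousSMul ℤ_[p] (W.tateModule p)] (κ : ZpExtension ℚ p)

/-! ## §9 The compatible family `ξ_a = cor_{Γ_{a₁}→Γ_0} (H¹(δ_0) (red_{p^{a₂}} x_{a₁}))` and its limit class -/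

omit [W.IsElliptic] [ContinuousSMul ℤ_[p] (W.tateModule p)] in
/-- `layerCores` is `coresLe` for ANY finiteness structure on `Γ_n / Γ_{n+1}` (the instance is a
subsingleton). [cite: Kato2004Asterisque, §12.2 (p. 220)] -/
theorem layerCores_eq_coresLe {A : Type} [CommRing A] [TopologicalSpace A] {M : Type} [AddCommGroup M]
    [Module A M] [TopologicalSpace M] [IsTopologicalAddGroup M] [ContinuousSMul A M]
    (T : GaloisRep ℚ A M) (n : ℕ)
    [Fintype (κ.layerSubgroup n ⧸ (κ.layerSubgroup (n + 1)).subgroupOf (κ.layerSubgroup n))]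
    (c : H1 T (κ.layerSubgroup (n + 1))) :
    layerCores T κ n c =
      coresLe T.toTopRep (κ.layerSubgroup_antitone (Nat.le_succ n)) (κ.isOpen_layerSubgroup (n + 1)) c := by
  unfold layerCores
  convert rfl

variable {W p κ} in
/-- **Iterated traces on the pin, `n ≤ n'`**: `cor_{Γ_{n'}→Γ_n} (proj n' y) = proj n y`
(`coresLe_proj_eq_proj` for `n < n'`, `coresLe_refl_apply` for `n = n'`).
[cite: Kato2004Asterisque, §12.2 (p. 220)] -/
theorem coresLe_proj_of_le {γ : absoluteGaloisGroup ℚ} (I : IwasawaH1Data W p κ γ) (y : I.H) {n n' : ℕ}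
    (h : n ≤ n')
    [hF : Fintype (κ.layerSubgroup n ⧸ (κ.layerSubgroup n').subgroupOf (κ.layerSubgroup n))] :
    coresLe (tateRep W p).toTopRep (κ.layerSubgroup_antitone h) (κ.isOpen_layerSubgroup n')
      (I.proj n' y) = I.proj n y := by
  rcases h.eq_or_lt with rfl | hlt
  · exact coresLe_refl_apply (tateRep W p).toTopRep (κ.layerSubgroup n) (κ.isOpen_layerSubgroup n) _
  · exact IwasawaH1LayerNorm.coresLe_proj_eq_proj I y hlt

variable {W p κ} in
/-- The reduced layer classes `x̄_a = red_{p^{a₂}} (proj a₁ x)` form a compatible family: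
`H¹([p^{b₂−a₂}]) (cor_{Γ_{b₁}→Γ_{a₁}} x̄_b) = x̄_a` for `a ≤ b`. [cite: Kato2004Asterisque, §12.2 (p. 220) and §13.8 (p. 228)] -/
theorem mapH1AddHom_torsionPowReduce_coresLe_reduceH1Pk_proj {γ : absoluteGaloisGroup ℚ}
    (I : IwasawaH1Data W p κ γ) (x : I.H) {a b : ℕ × ℕ} (h : a ≤ b)
    [Fintype (κ.layerSubgroup a.1 ⧸ (κ.layerSubgroup b.1).subgroupOf (κ.layerSubgroup a.1))]
    (hctp : Continuous (torsionPowReduce W p h.2)) :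
    mapH1AddHom (subgroupRep (W.torsionGaloisModule ((p : ℤ) ^ b.2)).toTopRep (κ.layerSubgroup a.1))
        (subgroupRep (W.torsionGaloisModule ((p : ℤ) ^ a.2)).toTopRep (κ.layerSubgroup a.1))
        (torsionPowReduce W p h.2) hctp (torsionPowReduce_subgroupRep W p h.2 (κ.layerSubgroup a.1))
        (coresLe (W.torsionGaloisModule ((p : ℤ) ^ b.2)).toTopRep (κ.layerSubgroup_antitone h.1)
          (κ.isOpen_layerSubgroup b.1) (reduceH1Pk W p b.2 (κ.layerSubgroup b.1) (I.proj b.1 x))) =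
      reduceH1Pk W p a.2 (κ.layerSubgroup a.1) (I.proj a.1 x) := by
  rw [← reduceH1Pk_coresLe W p b.2 (hF := _) (κ.layerSubgroup_antitone h.1) (κ.isOpen_layerSubgroup b.1)
      (I.proj b.1 x), coresLe_proj_of_le I x h.1]
  exact mapH1AddHom_torsionPowReduce_reduceH1Pk W p h.2 (κ.layerSubgroup a.1) hctp _

variable {W p κ} in
/-- **Compatibility of the family `ξ_a = cor_{Γ_{a₁}→Γ_0} (H¹(δ_0) x̄_a) ∈ H¹(Γ_0, P_a)` under the
transition maps**: `H¹(red) ξ_b = ξ_a` for `a ≤ b` (naturality of the inverse Shapiro map, §6, and the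
trace compatibility of the pin). [cite: Kato2004Asterisque, §12.2 (p. 220) and §13.8 (p. 228)] -/
theorem mapH1AddHom_red_xi {γ : absoluteGaloisGroup ℚ} (I : IwasawaH1Data W p κ γ) (x : I.H)
    {a b : ℕ × ℕ} (h : a ≤ b)
    [Fintype (κ.layerSubgroup 0 ⧸ (κ.layerSubgroup b.1).subgroupOf (κ.layerSubgroup 0))]
    [Fintype (κ.layerSubgroup 0 ⧸ (κ.layerSubgroup a.1).subgroupOf (κ.layerSubgroup 0))]
    [Fintype (κ.layerSubgroup a.1 ⧸ (κ.layerSubgroup b.1).subgroupOf (κ.layerSubgroup a.1))]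
    (hcr : Continuous (red W p h)) (hctp : Continuous (torsionPowReduce W p h.2))
    (hcsa : Continuous (AddMonoidHom.single (fun _ : ZMod (p ^ a.1) => geomTorsion W ((p : ℤ) ^ a.2)) 0))
    (hcsb : Continuous (AddMonoidHom.single (fun _ : ZMod (p ^ b.1) => geomTorsion W ((p : ℤ) ^ b.2)) 0)) :
    mapH1AddHom (subgroupRep ((system W p κ).ρ b).toTopRep (κ.layerSubgroup 0))
        (subgroupRep ((system W p κ).ρ a).toTopRep (κ.layerSubgroup 0)) (red W p h) hcr
        (red_subgroupRep W p κ h (κ.layerSubgroup 0))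
        (coresLe ((system W p κ).ρ b).toTopRep (κ.layerSubgroup_antitone (Nat.zero_le b.1))
          (κ.isOpen_layerSubgroup b.1)
          (mapH1AddHom (subgroupRep (W.torsionGaloisModule ((p : ℤ) ^ b.2)).toTopRep (κ.layerSubgroup b.1))
            (subgroupRep ((system W p κ).ρ b).toTopRep (κ.layerSubgroup b.1))
            (AddMonoidHom.single (fun _ : ZMod (p ^ b.1) => geomTorsion W ((p : ℤ) ^ b.2)) 0) hcsb
            (single_subgroupRep W p κ b le_rfl 0) (reduceH1Pk W p b.2 (κ.layerSubgroup b.1) (I.proj b.1 x)))) =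
      coresLe ((system W p κ).ρ a).toTopRep (κ.layerSubgroup_antitone (Nat.zero_le a.1))
        (κ.isOpen_layerSubgroup a.1)
        (mapH1AddHom (subgroupRep (W.torsionGaloisModule ((p : ℤ) ^ a.2)).toTopRep (κ.layerSubgroup a.1))
          (subgroupRep ((system W p κ).ρ a).toTopRep (κ.layerSubgroup a.1))
          (AddMonoidHom.single (fun _ : ZMod (p ^ a.1) => geomTorsion W ((p : ℤ) ^ a.2)) 0) hcsa
          (single_subgroupRep W p κ a le_rfl 0) (reduceH1Pk W p a.2 (κ.layerSubgroup a.1) (I.proj a.1 x))) := by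
  rw [mapH1AddHom_red_coresLe_single W p κ h hcr hctp hcsa hcsb,
    mapH1AddHom_torsionPowReduce_coresLe_reduceH1Pk_proj I x h hctp]

variable {W p κ} in
/-- **The limit class `Ξ ∈ H¹(Γ_0, 𝕋)` of the family `(ξ_a)_a`** — surjectivity of
`H¹(Γ_0, lim P_a) → lim_a H¹(Γ_0, P_a)` (NSW 2.7.5, surjective transitions `red`):
there is `Ξ` with `H¹(pr_a) Ξ = ξ_a` for every `a`. [cite: Kato2004Asterisque, §13.8 (p. 228)]
[cite: NeukirchSchmidtWingberg2008, II §7 Thm 2.7.5] -/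
theorem exists_limit_class {γ : absoluteGaloisGroup ℚ} (I : IwasawaH1Data W p κ γ) (x : I.H)
    [hF : ∀ m m' : ℕ, Fintype (κ.layerSubgroup m ⧸ (κ.layerSubgroup m').subgroupOf (κ.layerSubgroup m))]
    (hcp : ∀ a : ℕ × ℕ, Continuous ((system W p κ).projAddHom a))
    (hcs : ∀ a : ℕ × ℕ,
      Continuous (AddMonoidHom.single (fun _ : ZMod (p ^ a.1) => geomTorsion W ((p : ℤ) ^ a.2)) 0)) :
    ∃ Ξ : continuousCohomology 1 (subgroupRep (system W p κ).limitRep.toTopRep (κ.layerSubgroup 0)),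
      ∀ a : ℕ × ℕ,
        mapH1AddHom (subgroupRep (system W p κ).limitRep.toTopRep (κ.layerSubgroup 0))
          (subgroupRep ((system W p κ).ρ a).toTopRep (κ.layerSubgroup 0)) ((system W p κ).projAddHom a)
          (hcp a) (projAddHom_subgroupRep W p κ a (κ.layerSubgroup 0)) Ξ =
        coresLe ((system W p κ).ρ a).toTopRep (κ.layerSubgroup_antitone (Nat.zero_le a.1))
          (κ.isOpen_layerSubgroup a.1)
          (mapH1AddHom (subgroupRep (W.torsionGaloisModule ((p : ℤ) ^ a.2)).toTopRep (κ.layerSubgroup a.1))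
            (subgroupRep ((system W p κ).ρ a).toTopRep (κ.layerSubgroup a.1))
            (AddMonoidHom.single (fun _ : ZMod (p ^ a.1) => geomTorsion W ((p : ℤ) ^ a.2)) 0) (hcs a)
            (single_subgroupRep W p κ a le_rfl 0) (reduceH1Pk W p a.2 (κ.layerSubgroup a.1) (I.proj a.1 x))) := by
  have hcr : ∀ {a b : ℕ × ℕ} (h : a ≤ b), Continuous (red W p h) := fun _ => continuous_of_discreteTopology
  have hctp : ∀ {k k' : ℕ} (h : k ≤ k'), Continuous (torsionPowReduce W p h) :=
    fun _ => continuous_of_discreteTopology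
  -- the family as an element of `lim_a H¹(Γ_0, P_a)`
  let ξ : ∀ a : ℕ × ℕ, continuousCohomology 1 ((systemOn W p κ (κ.layerSubgroup 0)).ρ a).toTopRep :=
    fun a => coresLe ((system W p κ).ρ a).toTopRep (κ.layerSubgroup_antitone (Nat.zero_le a.1))
      (κ.isOpen_layerSubgroup a.1)
      (mapH1AddHom (subgroupRep (W.torsionGaloisModule ((p : ℤ) ^ a.2)).toTopRep (κ.layerSubgroup a.1))
        (subgroupRep ((system W p κ).ρ a).toTopRep (κ.layerSubgroup a.1))
        (AddMonoidHom.single (fun _ : ZMod (p ^ a.1) => geomTorsion W ((p : ℤ) ^ a.2)) 0) (hcs a)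
        (single_subgroupRep W p κ a le_rfl 0) (reduceH1Pk W p a.2 (κ.layerSubgroup a.1) (I.proj a.1 x)))
  have hξ : ∀ ⦃a b : ℕ × ℕ⦄ (h : (systemOn W p κ (κ.layerSubgroup 0)).le a b),
      cohomologyMap ((systemOn W p κ (κ.layerSubgroup 0)).redHom h) 1 (ξ b) = ξ a := fun a b h => by
    rw [cohomologyMap_systemOn_redHom W p κ (κ.layerSubgroup 0) h (hcr h)]
    exact mapH1AddHom_red_xi I x h (hcr h) (hctp h.2) (hcs a) (hcs b)
  obtain ⟨Ξ, hΞ⟩ := (systemOn W p κ (κ.layerSubgroup 0)).toCohomologyLimit₁_surjective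
    (diagonalChainOn W p κ (κ.layerSubgroup 0)) (fun h => red_surjective W p h) ⟨ξ, hξ⟩
  refine ⟨Ξ, fun a => ?_⟩
  have ha := congrArg (fun z : (systemOn W p κ (κ.layerSubgroup 0)).cohomologyLimit 1 =>
    (z : ∀ b, continuousCohomology 1 ((systemOn W p κ (κ.layerSubgroup 0)).ρ b).toTopRep) a) hΞ
  simp only [DiscreteInvSystem.coe_toCohomologyLimit₁_apply] at ha
  rw [cohomologyMap_systemOn_projHom W p κ (κ.layerSubgroup 0) a (hcp a)] at ha
  exact ha

omit [W.IsElliptic] [ContinuousSMul ℤ_[p] (W.tateModule p)] in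
/-- `shift − 1` is equivariant for every subgroup (hypothesis shape of `mapH1AddHom`).
[cite: Kato2004Asterisque, §14.14 (p. 243)] -/
theorem shift_sub_id_subgroupRep (H : Subgroup (absoluteGaloisGroup ℚ)) (u : H) (μ : (system W p κ).limit) :
    (shift W p κ - AddMonoidHom.id (system W p κ).limit)
        ((subgroupRep (system W p κ).limitRep.toTopRep H).ρ u μ) =
      (subgroupRep (system W p κ).limitRep.toTopRep H).ρ u
        ((shift W p κ - AddMonoidHom.id (system W p κ).limit) μ) := by
  rw [AddMonoidHom.sub_apply, AddMonoidHom.sub_apply, AddMonoidHom.id_apply, AddMonoidHom.id_apply,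
    shift_subgroupRep W p κ H u μ, map_sub]

omit [W.IsElliptic] [ContinuousSMul ℤ_[p] (W.tateModule p)] in
/-- `toTate 0 ∘ (shift − 1) = 0` (the composite in the short exact sequence `0 → 𝕋 → 𝕋 → T → 0`).
[cite: Kato2004Asterisque, §14.14 (p. 243)] -/
theorem toTate_zero_shift_sub_id (μ : (system W p κ).limit) :
    toTate W p κ 0 ((shift W p κ - AddMonoidHom.id (system W p κ).limit) μ) = 0 := by
  rw [AddMonoidHom.sub_apply, AddMonoidHom.id_apply, map_sub, toTate_zero_shift, sub_self]

/-! ## §10 `H¹(toTate n) ∘ res` of the limit class, the cochain `Θ` with `(shift − 1)Θ = Ξ` -/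

/-- `red_{p^k} (H¹(toTate n) (res_{Γ_0→Γ_n} c)) = H¹(ev_0) (res_{Γ_0→Γ_n} (H¹(pr_{(n,k)}) c))` for
`c ∈ H¹(Γ_0, 𝕋)`. [cite: Kato2004Asterisque, §13.8 (p. 228)] -/
theorem reduceH1Pk_mapH1AddHom_toTate_resLe (n k : ℕ) (hct : Continuous (toTate W p κ n))
    (hcp : Continuous ((system W p κ).projAddHom (n, k)))
    (hce : Continuous (Pi.evalAddMonoidHom (fun _ : ZMod (p ^ n) => geomTorsion W ((p : ℤ) ^ k)) 0))
    (c : continuousCohomology 1 (subgroupRep (system W p κ).limitRep.toTopRep (κ.layerSubgroup 0))) :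
    reduceH1Pk W p k (κ.layerSubgroup n)
        (mapH1AddHom (subgroupRep (system W p κ).limitRep.toTopRep (κ.layerSubgroup n))
          (subgroupRep (tateRep W p).toTopRep (κ.layerSubgroup n)) (toTate W p κ n) hct
          (toTate_subgroupRep W p κ n le_rfl)
          (resLe (system W p κ).limitRep.toTopRep (κ.layerSubgroup_antitone (Nat.zero_le n)) 1 c)) =
      mapH1AddHom (subgroupRep ((system W p κ).ρ (n, k)).toTopRep (κ.layerSubgroup n))
        (subgroupRep (W.torsionGaloisModule ((p : ℤ) ^ k)).toTopRep (κ.layerSubgroup n))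
        (Pi.evalAddMonoidHom (fun _ : ZMod (p ^ n) => geomTorsion W ((p : ℤ) ^ k)) 0) hce
        (eval_subgroupRep W p κ (n, k) le_rfl)
        (resLe ((system W p κ).ρ (n, k)).toTopRep (κ.layerSubgroup_antitone (Nat.zero_le n)) 1
          (mapH1AddHom (subgroupRep (system W p κ).limitRep.toTopRep (κ.layerSubgroup 0))
            (subgroupRep ((system W p κ).ρ (n, k)).toTopRep (κ.layerSubgroup 0)) ((system W p κ).projAddHom (n, k))
            hcp (projAddHom_subgroupRep W p κ (n, k) (κ.layerSubgroup 0)) c)) := by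
  rw [reduceH1Pk_mapH1AddHom_toTate W p κ n k le_rfl hct hcp hce,
    mapH1AddHom_resLe (X := (system W p κ).limitRep.toTopRep) (Y := ((system W p κ).ρ (n, k)).toTopRep)
      _ hcp (κ.layerSubgroup_antitone (Nat.zero_le n))
      (projAddHom_subgroupRep W p κ (n, k) (κ.layerSubgroup n))
      (projAddHom_subgroupRep W p κ (n, k) (κ.layerSubgroup 0))]

variable {W p κ} in
/-- **`H¹(toTate n) (res_{Γ_0→Γ_n} Ξ) = proj n x`**: both sides have the same reductions `x̄_{(n,k)}`
mod every `p^k` (Shapiro: `H¹(ev_0) ∘ res ∘ cor ∘ H¹(δ_0) = id`), and `H¹(ℚ_n, T)` is `p`-adically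
separated (`eq_of_forall_reduceH1Pk_eq`). [cite: Kato2004Asterisque, §13.8 (p. 228)] -/
theorem mapH1AddHom_toTate_resLe_limit_class {γ : absoluteGaloisGroup ℚ} (I : IwasawaH1Data W p κ γ) (x : I.H)
    [hF : ∀ m m' : ℕ, Fintype (κ.layerSubgroup m ⧸ (κ.layerSubgroup m').subgroupOf (κ.layerSubgroup m))]
    (hcp : ∀ a : ℕ × ℕ, Continuous ((system W p κ).projAddHom a))
    (hcs : ∀ a : ℕ × ℕ,
      Continuous (AddMonoidHom.single (fun _ : ZMod (p ^ a.1) => geomTorsion W ((p : ℤ) ^ a.2)) 0))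
    (hct : ∀ n, Continuous (toTate W p κ n))
    (Ξ : continuousCohomology 1 (subgroupRep (system W p κ).limitRep.toTopRep (κ.layerSubgroup 0)))
    (hΞ : ∀ a : ℕ × ℕ,
        mapH1AddHom (subgroupRep (system W p κ).limitRep.toTopRep (κ.layerSubgroup 0))
          (subgroupRep ((system W p κ).ρ a).toTopRep (κ.layerSubgroup 0)) ((system W p κ).projAddHom a)
          (hcp a) (projAddHom_subgroupRep W p κ a (κ.layerSubgroup 0)) Ξ =
        coresLe ((system W p κ).ρ a).toTopRep (κ.layerSubgroup_antitone (Nat.zero_le a.1))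
          (κ.isOpen_layerSubgroup a.1)
          (mapH1AddHom (subgroupRep (W.torsionGaloisModule ((p : ℤ) ^ a.2)).toTopRep (κ.layerSubgroup a.1))
            (subgroupRep ((system W p κ).ρ a).toTopRep (κ.layerSubgroup a.1))
            (AddMonoidHom.single (fun _ : ZMod (p ^ a.1) => geomTorsion W ((p : ℤ) ^ a.2)) 0) (hcs a)
            (single_subgroupRep W p κ a le_rfl 0) (reduceH1Pk W p a.2 (κ.layerSubgroup a.1) (I.proj a.1 x))))
    (n : ℕ) :
    mapH1AddHom (subgroupRep (system W p κ).limitRep.toTopRep (κ.layerSubgroup n))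
        (subgroupRep (tateRep W p).toTopRep (κ.layerSubgroup n)) (toTate W p κ n) (hct n)
        (toTate_subgroupRep W p κ n le_rfl)
        (resLe (system W p κ).limitRep.toTopRep (κ.layerSubgroup_antitone (Nat.zero_le n)) 1 Ξ) =
      I.proj n x := by
  refine eq_of_forall_reduceH1Pk_eq W p (κ.layerSubgroup n) fun k => ?_
  have hce : Continuous (Pi.evalAddMonoidHom (fun _ : ZMod (p ^ n) => geomTorsion W ((p : ℤ) ^ k)) 0) :=
    continuous_of_discreteTopology
  rw [reduceH1Pk_mapH1AddHom_toTate_resLe W p κ n k (hct n) (hcp (n, k)) hce, hΞ (n, k)]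
  exact mapH1AddHom_eval_resLe_coresLe_single (n, k) hce (hcs (n, k)) _

variable {W p κ} in
/-- For `proj 0 x = 0` the limit class dies under the augmentation: `H¹(toTate 0) Ξ = 0` in `H¹(Γ_0, T)`.
[cite: Kato2004Asterisque, §13.8 (p. 228) and §14.14 (p. 243)] -/
theorem mapH1AddHom_toTate_zero_limit_class {γ : absoluteGaloisGroup ℚ} (I : IwasawaH1Data W p κ γ) (x : I.H)
    [hF : ∀ m m' : ℕ, Fintype (κ.layerSubgroup m ⧸ (κ.layerSubgroup m').subgroupOf (κ.layerSubgroup m))]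
    (hcp : ∀ a : ℕ × ℕ, Continuous ((system W p κ).projAddHom a))
    (hcs : ∀ a : ℕ × ℕ,
      Continuous (AddMonoidHom.single (fun _ : ZMod (p ^ a.1) => geomTorsion W ((p : ℤ) ^ a.2)) 0))
    (hct : ∀ n, Continuous (toTate W p κ n))
    (Ξ : continuousCohomology 1 (subgroupRep (system W p κ).limitRep.toTopRep (κ.layerSubgroup 0)))
    (hΞ : ∀ a : ℕ × ℕ,
        mapH1AddHom (subgroupRep (system W p κ).limitRep.toTopRep (κ.layerSubgroup 0))
          (subgroupRep ((system W p κ).ρ a).toTopRep (κ.layerSubgroup 0)) ((system W p κ).projAddHom a)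
          (hcp a) (projAddHom_subgroupRep W p κ a (κ.layerSubgroup 0)) Ξ =
        coresLe ((system W p κ).ρ a).toTopRep (κ.layerSubgroup_antitone (Nat.zero_le a.1))
          (κ.isOpen_layerSubgroup a.1)
          (mapH1AddHom (subgroupRep (W.torsionGaloisModule ((p : ℤ) ^ a.2)).toTopRep (κ.layerSubgroup a.1))
            (subgroupRep ((system W p κ).ρ a).toTopRep (κ.layerSubgroup a.1))
            (AddMonoidHom.single (fun _ : ZMod (p ^ a.1) => geomTorsion W ((p : ℤ) ^ a.2)) 0) (hcs a)
            (single_subgroupRep W p κ a le_rfl 0) (reduceH1Pk W p a.2 (κ.layerSubgroup a.1) (I.proj a.1 x))))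
    (hx : I.proj 0 x = 0) :
    mapH1AddHom (subgroupRep (system W p κ).limitRep.toTopRep (κ.layerSubgroup 0))
        (subgroupRep (tateRep W p).toTopRep (κ.layerSubgroup 0)) (toTate W p κ 0) (hct 0)
        (toTate_subgroupRep W p κ 0 le_rfl) Ξ = 0 := by
  have h := mapH1AddHom_toTate_resLe_limit_class I x hcp hcs hct Ξ hΞ 0
  rw [resLe_refl_apply, hx] at h
  exact h

/-- **The class `Θ ∈ H¹(Γ_0, 𝕋)` with `H¹(shift − 1) Θ = Ξ`**: exactness of
`H¹(Γ_0, 𝕋) →(shift−1) H¹(Γ_0, 𝕋) →(toTate 0) H¹(Γ_0, T)` for the closed-embedding short exact sequence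
`0 → 𝕋 → 𝕋 → T → 0` of `Kato2004.IwasawaTwistTateExactProofs`.
[cite: Kato2004Asterisque, §14.14 (p. 243)] [cite: NeukirchSchmidtWingberg2008, II §7 Lemma 2.7.2] -/
theorem exists_shift_sub_class (hcsh : Continuous ⇑(shift W p κ - AddMonoidHom.id (system W p κ).limit))
    (hct0 : Continuous (toTate W p κ 0))
    (Ξ : continuousCohomology 1 (subgroupRep (system W p κ).limitRep.toTopRep (κ.layerSubgroup 0)))
    (hΞ0 : mapH1AddHom (subgroupRep (system W p κ).limitRep.toTopRep (κ.layerSubgroup 0))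
        (subgroupRep (tateRep W p).toTopRep (κ.layerSubgroup 0)) (toTate W p κ 0) hct0
        (toTate_subgroupRep W p κ 0 le_rfl) Ξ = 0) :
    ∃ Θ : continuousCohomology 1 (subgroupRep (system W p κ).limitRep.toTopRep (κ.layerSubgroup 0)),
      mapH1AddHom (subgroupRep (system W p κ).limitRep.toTopRep (κ.layerSubgroup 0))
        (subgroupRep (system W p κ).limitRep.toTopRep (κ.layerSubgroup 0)) (shift W p κ - AddMonoidHom.id (system W p κ).limit)
        hcsh (shift_sub_id_subgroupRep W p κ (κ.layerSubgroup 0)) Θ = Ξ := by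
  refine exists_mapH1AddHom_eq_of_mapH1AddHom_eq_zero
    (X₁ := subgroupRep (system W p κ).limitRep.toTopRep (κ.layerSubgroup 0))
    (X₂ := subgroupRep (system W p κ).limitRep.toTopRep (κ.layerSubgroup 0))
    (X₃ := subgroupRep (tateRep W p).toTopRep (κ.layerSubgroup 0)) _ hcsh _ (toTate W p κ 0) hct0
    ?_ (toTate_subgroupRep W p κ 0 le_rfl) (toTate_surjective W p κ 0) ?_ ?_ Ξ hΞ0
  · exact (isClosedEmbedding_shift_sub W p κ).isEmbedding
  · intro μ hμ
    obtain ⟨ν, hν⟩ := exists_shift_sub_eq_of_toTate_zero_eq_zero W p κ μ hμ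
    exact ⟨ν, hν⟩
  · intro w
    exact ((system W p κ).limitRep.continuous_apply_left w).comp continuous_subtype_val

end TwistTate

end Literature.NumberTheory.EllipticCurves.Kato2004

end
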